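import Summits.QuantumFields.BalabanUV.T4Continuum.Support.NE7K1LinSchurLineU1
import Summits.QuantumFields.BalabanUV.T4Continuum.Support.NE7K1LinSchurLineDeriv

/-!
# NE7K1LinTwoRunKit — row NE7 (node U5), candidate route HOM, path H1L, cell K1-lin(s): the KIT for the TWO-RUN COMPARISON
# at `A = 0` — completing the square over the fine block, block labels of fine neighbours, block sums of `T(V,ψ)`, and the
# AVERAGING IDENTITY between run B's `aP_{j+1}(0)` and run A's `aP_j(0)`

Lineage `b2b-balaban-t4-ne7-p2` (CRUX PROVER NE7 #2), generation 64.  WHY.  `NE7K1LinSchurLineDerivRel` showed that the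
η-UNIFORM `∂_s` letter of the interpolated two-cutoff line needs the TWO-RUN COMPARABILITY `c₁·P_A ≤ P_B^{Schur} ≤ C₁·P_A`
(a K1-var-type input), the `ℓ²`∕Schur-test currency of `NE7K1LinSchurLineDeriv` being mesh-dependent at U = 1.  This kit
carries the pieces common to both halves of that comparison for the objects of `NE7K1LinSchurLineU1` (`runA = fineOpR n a 0 R`,
`R = R′.image (blk L)`; `runB = (L^{d+1})⁻¹·Tᵀ·fineOpR (nL) a 0 R′·T` in block coordinates `(V,ψ)`):

* §1 ([folklore], abstract) completing the square over the fine block: for `H = [[A,B],[C,D]]` with `Bᵀ = C`, `D` symmetric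
  invertible, `⟨(V,ψ), H(V,ψ)⟩ = ⟨V,(A − BD⁻¹C)V⟩ + ⟨ψ − ψ_*, D(ψ − ψ_*)⟩`, `ψ_* = −D⁻¹CV` (`schur_form_decomp`); hence for
  `D ≥ 0` the Schur form is BELOW every trial (`schur_form_le`) and is ATTAINED at `ψ_*` (`schur_form_eq_min`).
* §2 lattice bookkeeping on a union `R′` of `L`-blocks: block labels of fine nearest neighbours are equal or coarse nearest
  neighbours, injectively (`blk_add_uvec`, `blk_sub_uvec`, `blk_nbr_cases`, `nbr_eq_of_blk_eq`); the per-point bound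
  `Σ_{y′~x′}(V(blk x′) − V(blk y′))² ≤ Σ_{y~blk x′}(V(blk x′) − V(y))²` (`fine_nbr_sum_le`); `Σ_{x′}G(blk x′) = L^{d+1}Σ_bG(b)`
  (`sum_comp_rblk`); the `n`-block labels of `R` ARE the `nL`-block labels of `R′` (`image_blk_blk`, `sum_filter_blk_mul`).
* §3 the block-constant trial `T(V,0) = V ∘ blk` (`coordT_inl`); the BLOCK SUMS of ANY `T(V,ψ)` are `L^{d+1}V_b`
  (`blockSum_coordT`); the AVERAGING IDENTITY: for a fine function with `L`-block sums `L^{d+1}V_b`, run B's `aP_{j+1}(0)` form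
  times the density ratio `L^{−(d+1)}` EQUALS run A's `aP_j(0)` form at `V` (`avgPart_eq`).

HONEST FRAMING: Gaussian `A = 0`, finite regions, [folklore] bookkeeping over the tree's `B4Lower18` ∕ `NE7K1LinBlockCoords`;
nothing printed asserted; no `sorry`.  FIXED FINITE T⁴, rung (B)+1; NE7 NOT PRINTED ∕ NOT PROVED; spine 0∕9; NOT infinite volume,
NOT mass gap, NOT Clay.  HONEST DEPENDENCY: continuum YM on T⁴ ⇐ BetaPertH ∧ nine spine estimates (0/9 proved); BetaPertH ⇐
(D1) ∧ (D4) ∧ CAP+tail; G-an2-4 gates asym, D1 and NE2/3/4.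
-/

noncomputable section

open Finset Matrix

namespace Summit.QuantumFields.BalabanUV.T4Continuum.NE7K1LinTwoRunKit

open Literature.MathematicalPhysics.QuantumFieldTheory.Balaban1983to89
open Literature.MathematicalPhysics.QuantumFieldTheory.Balaban1983to89.B4Reflection242
open Literature.MathematicalPhysics.QuantumFieldTheory.Balaban1983to89.B4BoxCov237
open Literature.MathematicalPhysics.QuantumFieldTheory.Balaban1983to89.B4Lower18
open Literature.MathematicalPhysics.QuantumFieldTheory.Balaban1983to89.B4Thm110ZeroBox (blk_blk)
open NE7K1LinSchurLineForm NE7K1LinSchurLineCoords NE7K1LinBlockCoords NE7K1LinSchurLineU1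

variable {d : ℕ}

/-! ### §1 Completing the square over the fine block -/

section Schur

variable {ιc ιf : Type*} [Fintype ιc] [Fintype ιf] [DecidableEq ιf]
variable (A : Matrix ιc ιc ℝ) (B : Matrix ιc ιf ℝ) (C : Matrix ιf ιc ℝ) (D : Matrix ιf ιf ℝ)

/-- **COMPLETING THE SQUARE**: `⟨(V,ψ), H(V,ψ)⟩ = ⟨V,(A − BD⁻¹C)V⟩ + ⟨ψ + D⁻¹CV, D(ψ + D⁻¹CV)⟩` (`Bᵀ = C`, `D` symmetric
invertible). [folklore] -/
theorem schur_form_decomp (hBC : Bᵀ = C) (hD : D.IsSymm) (hDu : IsUnit D.det) (V : ιc → ℝ) (ψ : ιf → ℝ) :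
    Sum.elim V ψ ⬝ᵥ (fromBlocks A B C D).mulVec (Sum.elim V ψ) =
      V ⬝ᵥ (A - B * D⁻¹ * C).mulVec V +
        (ψ + D⁻¹.mulVec (C.mulVec V)) ⬝ᵥ D.mulVec (ψ + D⁻¹.mulVec (C.mulVec V)) := by
  set x := D⁻¹.mulVec (C.mulVec V) with hx
  have hDx : D.mulVec x = C.mulVec V := by rw [hx, mulVec_mulVec, mul_nonsing_inv _ hDu, one_mulVec]
  have hVB : ∀ φ : ιf → ℝ, V ⬝ᵥ B.mulVec φ = φ ⬝ᵥ C.mulVec V := fun φ => by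
    rw [dotProduct_mulVec, ← mulVec_transpose, hBC, dotProduct_comm]
  have hDsym : ∀ φ φ' : ιf → ℝ, φ ⬝ᵥ D.mulVec φ' = φ' ⬝ᵥ D.mulVec φ := fun φ φ' => by
    rw [dotProduct_mulVec, ← mulVec_transpose, hD.eq, dotProduct_comm]
  have h1 : V ⬝ᵥ (A - B * D⁻¹ * C).mulVec V = V ⬝ᵥ A.mulVec V - x ⬝ᵥ C.mulVec V := by
    rw [sub_mulVec, dotProduct_sub, ← mulVec_mulVec, ← mulVec_mulVec, ← hx, hVB x]
  have h2 : (ψ + x) ⬝ᵥ D.mulVec (ψ + x) = ψ ⬝ᵥ D.mulVec ψ + 2 * (ψ ⬝ᵥ C.mulVec V) + x ⬝ᵥ C.mulVec V := by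
    rw [mulVec_add, add_dotProduct, dotProduct_add, dotProduct_add, hDsym x ψ, hDx]; ring
  rw [fromBlocks_mulVec, Sum.elim_comp_inl, Sum.elim_comp_inr, sumElim_dotProduct_sumElim, dotProduct_add, dotProduct_add,
    hVB ψ, h1, h2]
  ring

/-- **THE SCHUR FORM IS BELOW EVERY TRIAL** (`D ≥ 0`): `⟨V,(A − BD⁻¹C)V⟩ ≤ ⟨(V,ψ), H(V,ψ)⟩`. [folklore] -/
theorem schur_form_le (hBC : Bᵀ = C) (hD : D.IsSymm) (hDu : IsUnit D.det) (hDpsd : ∀ φ : ιf → ℝ, 0 ≤ φ ⬝ᵥ D.mulVec φ)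
    (V : ιc → ℝ) (ψ : ιf → ℝ) :
    V ⬝ᵥ (A - B * D⁻¹ * C).mulVec V ≤ Sum.elim V ψ ⬝ᵥ (fromBlocks A B C D).mulVec (Sum.elim V ψ) := by
  rw [schur_form_decomp A B C D hBC hD hDu]
  linarith [hDpsd (ψ + D⁻¹.mulVec (C.mulVec V))]

/-- **THE SCHUR FORM IS ATTAINED** at `ψ_* = −D⁻¹CV`. [folklore] -/
theorem schur_form_eq_min (hBC : Bᵀ = C) (hD : D.IsSymm) (hDu : IsUnit D.det) (V : ιc → ℝ) :
    V ⬝ᵥ (A - B * D⁻¹ * C).mulVec V =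
      Sum.elim V (-(D⁻¹.mulVec (C.mulVec V))) ⬝ᵥ (fromBlocks A B C D).mulVec (Sum.elim V (-(D⁻¹.mulVec (C.mulVec V)))) := by
  rw [schur_form_decomp A B C D hBC hD hDu, neg_add_cancel, zero_dotProduct, add_zero]

end Schur

/-! ### §2 Lattice bookkeeping: block labels of fine neighbours -/

section Lattice

variable {L : ℕ}

/-- one floor-division step up: `(a+1)∕L = a∕L` or `a∕L + 1` (`L ≥ 1`). [folklore] -/
theorem ediv_add_one_eq_or (hL : 1 ≤ L) (a : ℤ) : (a + 1) / (L : ℤ) = a / (L : ℤ) ∨ (a + 1) / (L : ℤ) = a / (L : ℤ) + 1 := by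
  have hL0 : (0 : ℤ) < L := by exact_mod_cast hL
  have h1 : a / (L : ℤ) ≤ (a + 1) / (L : ℤ) := Int.ediv_le_ediv hL0 (by omega)
  have h2 : (a + 1) / (L : ℤ) ≤ (a + L) / (L : ℤ) := Int.ediv_le_ediv hL0 (by omega)
  rw [show a + (L : ℤ) = a + 1 * (L : ℤ) by ring, Int.add_mul_ediv_right _ _ hL0.ne'] at h2
  omega

/-- one floor-division step down: `(a−1)∕L = a∕L` or `a∕L − 1` (`L ≥ 1`). [folklore] -/
theorem ediv_sub_one_eq_or (hL : 1 ≤ L) (a : ℤ) : (a - 1) / (L : ℤ) = a / (L : ℤ) ∨ (a - 1) / (L : ℤ) = a / (L : ℤ) - 1 := by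
  rcases ediv_add_one_eq_or hL (a - 1) with h | h <;> rw [sub_add_cancel] at h <;> omega

/-- the block label of `x + e_i` is `blk x` or `blk x + e_i`. [folklore] -/
theorem blk_add_uvec (hL : 1 ≤ L) (x : Fin (d + 1) → ℤ) (i : Fin (d + 1)) :
    blk L (x + uvec i) = blk L x ∨ blk L (x + uvec i) = blk L x + uvec i := by
  rcases ediv_add_one_eq_or hL (x i) with h | h
  · left; ext j; by_cases hj : j = i
    · subst hj; simp only [blk, Pi.add_apply, uvec_apply_same, h]
    · simp only [blk, Pi.add_apply, uvec_apply_ne hj, add_zero]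
  · right; ext j; by_cases hj : j = i
    · subst hj; simp only [blk, Pi.add_apply, uvec_apply_same, h]
    · simp only [blk, Pi.add_apply, uvec_apply_ne hj, add_zero]

/-- the block label of `x − e_i` is `blk x` or `blk x − e_i`. [folklore] -/
theorem blk_sub_uvec (hL : 1 ≤ L) (x : Fin (d + 1) → ℤ) (i : Fin (d + 1)) :
    blk L (x - uvec i) = blk L x ∨ blk L (x - uvec i) = blk L x - uvec i := by
  rcases ediv_sub_one_eq_or hL (x i) with h | h
  · left; ext j; by_cases hj : j = i
    · subst hj; simp only [blk, Pi.sub_apply, uvec_apply_same, h]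
    · simp only [blk, Pi.sub_apply, uvec_apply_ne hj, sub_zero]
  · right; ext j; by_cases hj : j = i
    · subst hj; simp only [blk, Pi.sub_apply, uvec_apply_same, h]
    · simp only [blk, Pi.sub_apply, uvec_apply_ne hj, sub_zero]

/-- a fine neighbour `z ~ x` has `blk z = blk x`, or `blk z = blk x ± e_i` TOGETHER WITH `z = x ± e_i` (same `i`, same sign).
[folklore] -/
theorem blk_nbr_cases (hL : 1 ≤ L) {x z : Fin (d + 1) → ℤ} (hz : z ∈ nbrs x) :
    blk L z = blk L x ∨ ∃ i, (z = x + uvec i ∧ blk L z = blk L x + uvec i) ∨ (z = x - uvec i ∧ blk L z = blk L x - uvec i) := by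
  obtain ⟨i, hi | hi⟩ := mem_nbrs.1 hz
  · have hi' : z = x + uvec i := hi
    rcases blk_add_uvec hL x i with h | h
    · left; rw [hi', h]
    · right; exact ⟨i, Or.inl ⟨hi', by rw [hi', h]⟩⟩
  · have hi' : z = x - uvec i := hi
    rcases blk_sub_uvec hL x i with h | h
    · left; rw [hi', h]
    · right; exact ⟨i, Or.inr ⟨hi', by rw [hi', h]⟩⟩

/-- a fine neighbour in a different block lies in a COARSE-neighbouring block. [folklore] -/
theorem blk_nbr_mem_nbrs (hL : 1 ≤ L) {x z : Fin (d + 1) → ℤ} (hz : z ∈ nbrs x) (hne : blk L z ≠ blk L x) :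
    blk L z ∈ nbrs (blk L x) := by
  rcases blk_nbr_cases hL hz with h | ⟨i, ⟨_, h⟩ | ⟨_, h⟩⟩
  · exact absurd h hne
  · exact mem_nbrs.2 ⟨i, Or.inl h⟩
  · exact mem_nbrs.2 ⟨i, Or.inr h⟩

/-- two fine neighbours of `x` in the SAME block different from `blk x` coincide. [folklore] -/
theorem nbr_eq_of_blk_eq (hL : 1 ≤ L) {x z z' : Fin (d + 1) → ℤ} (hz : z ∈ nbrs x) (hz' : z' ∈ nbrs x)
    (hne : blk L z ≠ blk L x) (heq : blk L z = blk L z') : z = z' := by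
  have hne' : blk L z' ≠ blk L x := fun h => hne (heq.trans h)
  rcases blk_nbr_cases hL hz with h | ⟨i, ⟨hz1, h⟩ | ⟨hz1, h⟩⟩
  · exact absurd h hne
  · rcases blk_nbr_cases hL hz' with h' | ⟨i', ⟨hz2, h'⟩ | ⟨hz2, h'⟩⟩
    · exact absurd h' hne'
    · have hii : uvec (d := d) i = uvec i' := add_left_cancel (h.symm.trans (heq.trans h'))
      rw [hz1, hz2, hii]
    · exfalso
      have h3 : blk L x + uvec i = blk L x - uvec i' := h.symm.trans (heq.trans h')
      exact uvec_add_uvec_ne_zero i i' (by linear_combination h3)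
  · rcases blk_nbr_cases hL hz' with h' | ⟨i', ⟨hz2, h'⟩ | ⟨hz2, h'⟩⟩
    · exact absurd h' hne'
    · exfalso
      have h3 : blk L x - uvec i = blk L x + uvec i' := h.symm.trans (heq.trans h')
      exact uvec_add_uvec_ne_zero i' i (by linear_combination -h3)
    · have hii : uvec (d := d) i = uvec i' := by
        have h3 : blk L x - uvec i = blk L x - uvec i' := h.symm.trans (heq.trans h')
        exact sub_right_injective h3
      rw [hz1, hz2, hii]

/-- the two block structures: the `n`-block labels of `R = R′.image (blk L)` ARE the `nL`-block labels of `R′`. [folklore] -/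
theorem image_blk_blk (n : ℕ) (R' : Finset (Fin (d + 1) → ℤ)) :
    (R'.image (blk L)).image (blk n) = R'.image (blk (n * L)) := by
  rw [Finset.image_image]
  congr 1
  funext x
  simp only [Function.comp_apply, blk_blk, Nat.mul_comm]

/-- the `nL`-block sum of a fine function splits over the `L`-blocks it contains. [folklore] -/
theorem sum_filter_blk_mul (n : ℕ) {R' : Finset (Fin (d + 1) → ℤ)} (φ : ↥R' → ℝ) (B : Fin (d + 1) → ℤ) :
    ∑ x' ∈ Finset.univ.filter (fun x' : ↥R' => blk (n * L) x'.1 = B), φ x' =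
      ∑ b : ↥(R'.image (blk L)), if blk n b.1 = B then ∑ x' ∈ Finset.univ.filter (fun x' => rblk L R' x' = b), φ x' else 0 := by
  classical
  rw [← Finset.sum_fiberwise_of_maps_to (g := rblk L R') (t := Finset.univ) (fun _ _ => Finset.mem_univ _)]
  refine Finset.sum_congr rfl fun b _ => ?_
  by_cases hb : blk n b.1 = B
  · rw [if_pos hb, Finset.filter_filter]
    refine Finset.sum_congr (Finset.filter_congr fun x' _ => ⟨fun h => h.2, fun h => ⟨?_, h⟩⟩) fun _ _ => rfl
    rw [← hb, ← h, Nat.mul_comm, ← blk_blk]; rfl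
  · rw [if_neg hb]
    refine Finset.sum_eq_zero fun x' hx' => ?_
    exfalso
    simp only [Finset.mem_filter, Finset.mem_univ, true_and] at hx'
    apply hb
    rw [← hx'.2, ← hx'.1, Nat.mul_comm, ← blk_blk]; rfl

variable [NeZero L] {R' : Finset (Fin (d + 1) → ℤ)}

/-- **PER-POINT BOUND**: the fine nearest-neighbour sum of a block-constant function is below the coarse nearest-neighbour sum
at the block label: `Σ_{y′∈R′, y′~x′}(V(blk x′) − V(blk y′))² ≤ Σ_{y∈R, y~blk x′}(V(blk x′) − V(y))²`. [folklore] -/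
theorem fine_nbr_sum_le (V : ↥(R'.image (blk L)) → ℝ) (x' : ↥R') :
    ∑ y' : ↥R', (if y'.1 ∈ nbrs x'.1 then (V (rblk L R' x') - V (rblk L R' y')) ^ 2 else 0) ≤
      ∑ y : ↥(R'.image (blk L)), (if y.1 ∈ nbrs (rblk L R' x').1 then (V (rblk L R' x') - V y) ^ 2 else 0) := by
  classical
  have hL : 1 ≤ L := NeZero.one_le
  set S₁ : Finset ↥R' := (Finset.univ.filter fun y' : ↥R' => y'.1 ∈ nbrs x'.1).filter
    fun y' => rblk L R' y' ≠ rblk L R' x' with hS₁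
  set T : Finset ↥(R'.image (blk L)) := Finset.univ.filter fun y => y.1 ∈ nbrs (rblk L R' x').1 with hT
  -- the fine sum only sees neighbours in other blocks
  have hlhs : ∑ y' : ↥R', (if y'.1 ∈ nbrs x'.1 then (V (rblk L R' x') - V (rblk L R' y')) ^ 2 else 0) =
      ∑ y' ∈ S₁, (V (rblk L R' x') - V (rblk L R' y')) ^ 2 := by
    rw [← Finset.sum_filter, hS₁]
    symm
    apply Finset.sum_filter_of_ne
    intro y' _ hne h
    apply hne
    rw [h, sub_self, zero_pow two_ne_zero]
  have hrhs : ∑ y : ↥(R'.image (blk L)), (if y.1 ∈ nbrs (rblk L R' x').1 then (V (rblk L R' x') - V y) ^ 2 else 0) =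
      ∑ y ∈ T, (V (rblk L R' x') - V y) ^ 2 := by rw [← Finset.sum_filter]
  rw [hlhs, hrhs]
  -- injectivity of the block label on `S₁` and the image lands in `T`
  have hinj : Set.InjOn (rblk L R') ↑S₁ := by
    intro y₁ h₁ y₂ h₂ h
    simp only [Finset.coe_filter, Finset.mem_filter, Finset.mem_univ, true_and, Set.mem_setOf_eq, hS₁] at h₁ h₂
    have hne : blk L y₁.1 ≠ blk L x'.1 := fun e => h₁.2 (Subtype.ext e)
    exact Subtype.ext (nbr_eq_of_blk_eq hL h₁.1 h₂.1 hne (congrArg Subtype.val h))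
  have hsub : S₁.image (rblk L R') ⊆ T := by
    intro y hy
    obtain ⟨y', hy', rfl⟩ := Finset.mem_image.1 hy
    simp only [Finset.mem_filter, Finset.mem_univ, true_and, hS₁] at hy'
    simp only [hT, Finset.mem_filter, Finset.mem_univ, true_and]
    exact blk_nbr_mem_nbrs hL hy'.1 (fun e => hy'.2 (Subtype.ext e))
  calc ∑ y' ∈ S₁, (V (rblk L R' x') - V (rblk L R' y')) ^ 2
      = ∑ y ∈ S₁.image (rblk L R'), (V (rblk L R' x') - V y) ^ 2 :=
        (Finset.sum_image (f := fun y => (V (rblk L R' x') - V y) ^ 2) hinj).symm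
    _ ≤ ∑ y ∈ T, (V (rblk L R' x') - V y) ^ 2 :=
        Finset.sum_le_sum_of_subset_of_nonneg hsub fun y _ _ => sq_nonneg _

/-- sums of block-label functions: `Σ_{x′∈R′} G(blk x′) = L^{d+1}·Σ_b G(b)`. [folklore] -/
theorem sum_comp_rblk (hR'L : IsBlockUnion L R') (G : ↥(R'.image (blk L)) → ℝ) :
    ∑ x' : ↥R', G (rblk L R' x') = (L : ℝ) ^ (d + 1) * ∑ b : ↥(R'.image (blk L)), G b := by
  rw [sum_eq_sum_blocks hR'L, Finset.mul_sum]
  refine Finset.sum_congr rfl fun b _ => ?_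
  simp only [rblk_rchart, Finset.sum_const, Finset.card_univ, Fintype.card_fun, Fintype.card_fin, nsmul_eq_mul]
  push_cast
  ring

end Lattice

/-! ### §3 The block-constant trial, block sums, the averaging identity -/

section Trial

variable {n L : ℕ} [NeZero L] {R' : Finset (Fin (d + 1) → ℤ)} (hR'L : IsBlockUnion L R')

/-- the block-constant trial: `T(V,0) = V ∘ blk`. [folklore] -/
theorem coordT_inl (V : ↥(R'.image (blk L)) → ℝ) :
    (coordT hR'L).mulVec (Sum.elim V 0) = fun x' => V (rblk L R' x') := by
  ext x'
  obtain ⟨j, hj⟩ := rchart_surj NeZero.one_le hR'L x'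
  rw [← hj, coordT_mulVec_rchart, rblk_rchart]
  simp only [Sum.elim_inl, Sum.elim_inr, Pi.zero_apply, Finset.sum_const_zero, neg_zero, dite_eq_ite, ite_self, add_zero]

/-- **BLOCK SUMS OF `T(V,ψ)` ARE `L^{d+1}V_b`** (the fluctuation profile sums to zero over each block). [folklore] -/
theorem blockSum_coordT (u : ↥(R'.image (blk L)) ⊕ (↥(R'.image (blk L)) × NZ d L) → ℝ) (b : ↥(R'.image (blk L))) :
    ∑ x' ∈ Finset.univ.filter (fun x' => rblk L R' x' = b), (coordT hR'L).mulVec u x' = (L : ℝ) ^ (d + 1) * u (Sum.inl b) := by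
  classical
  rw [filter_rblk_eq_image NeZero.one_le hR'L b, Finset.sum_image fun j _ j' _ h => rchart_injective NeZero.one_le hR'L b h]
  simp_rw [coordT_mulVec_rchart]
  rw [Finset.sum_add_distrib, Finset.sum_const, Finset.card_univ, Fintype.card_fun, Fintype.card_fin, Fintype.card_fin,
    nsmul_eq_mul, sum_offsets_split]
  simp only [ne_eq, not_true_eq_false, dite_false]
  have : ∀ j' : NZ d L, (if h : ¬ (j'.1 = 0) then u (Sum.inr (b, ⟨j'.1, h⟩)) else -∑ j'', u (Sum.inr (b, j''))) =
      u (Sum.inr (b, j')) := fun j' => by rw [dif_pos j'.2]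
  simp_rw [this]
  push_cast
  ring

/-- **THE AVERAGING IDENTITY**: for a fine function whose `L`-block sums are `L^{d+1}V_b`, run B's `aP_{j+1}(0)` form times the
density ratio `L^{−(d+1)}` EQUALS run A's `aP_j(0)` form at `V`. [folklore] -/
theorem avgPart_eq (hn : 1 ≤ n) (a : ℝ) (φ : ↥R' → ℝ) (V : ↥(R'.image (blk L)) → ℝ)
    (hφ : ∀ b, ∑ x' ∈ Finset.univ.filter (fun x' => rblk L R' x' = b), φ x' = (L : ℝ) ^ (d + 1) * V b) :
    ((L : ℝ) ^ (d + 1))⁻¹ * (a * (((n * L : ℕ) : ℝ) ^ (d + 1))⁻¹ *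
      ∑ B : ↥(R'.image (blk (n * L))), (∑ x' ∈ Finset.univ.filter (fun x' => rblk (n * L) R' x' = B), φ x') ^ 2) =
      a * ((n : ℝ) ^ (d + 1))⁻¹ * ∑ B₀ : ↥((R'.image (blk L)).image (blk n)),
        (∑ b ∈ Finset.univ.filter (fun b => rblk n (R'.image (blk L)) b = B₀), V b) ^ 2 := by
  classical
  have hL0 : (L : ℝ) ≠ 0 := by exact_mod_cast (NeZero.ne L)
  have hn0 : (n : ℝ) ≠ 0 := by exact_mod_cast (Nat.one_le_iff_ne_zero.1 hn)
  -- both sides as sums over the common label set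
  have hlhs : ∑ B : ↥(R'.image (blk (n * L))), (∑ x' ∈ Finset.univ.filter (fun x' => rblk (n * L) R' x' = B), φ x') ^ 2 =
      ∑ B ∈ R'.image (blk (n * L)), ((L : ℝ) ^ (d + 1) * ∑ b : ↥(R'.image (blk L)), if blk n b.1 = B then V b else 0) ^ 2 := by
    rw [← Finset.sum_coe_sort (R'.image (blk (n * L)))]
    refine Finset.sum_congr rfl fun B _ => ?_
    have h1 : Finset.univ.filter (fun x' : ↥R' => rblk (n * L) R' x' = B) =
        Finset.univ.filter (fun x' : ↥R' => blk (n * L) x'.1 = B.1) :=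
      Finset.filter_congr fun x' _ => by rw [Subtype.ext_iff]; rfl
    rw [h1, sum_filter_blk_mul n, Finset.mul_sum]
    congr 1
    refine Finset.sum_congr rfl fun b _ => ?_
    split_ifs with hb
    · exact hφ b
    · rw [mul_zero]
  have hrhs : ∑ B₀ : ↥((R'.image (blk L)).image (blk n)),
      (∑ b ∈ Finset.univ.filter (fun b => rblk n (R'.image (blk L)) b = B₀), V b) ^ 2 =
      ∑ B ∈ R'.image (blk (n * L)), (∑ b : ↥(R'.image (blk L)), if blk n b.1 = B then V b else 0) ^ 2 := by
    rw [← image_blk_blk n R', ← Finset.sum_coe_sort ((R'.image (blk L)).image (blk n))]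
    refine Finset.sum_congr rfl fun B₀ _ => ?_
    rw [Finset.sum_filter]
    congr 1
    refine Finset.sum_congr rfl fun b _ => ?_
    have : (rblk n (R'.image (blk L)) b = B₀) ↔ (blk n b.1 = B₀.1) := by rw [Subtype.ext_iff]; rfl
    simp only [this]
  have key : ((L : ℝ) ^ (d + 1))⁻¹ * (a * (((n * L : ℕ) : ℝ) ^ (d + 1))⁻¹) * ((L : ℝ) ^ (d + 1)) ^ 2 =
      a * ((n : ℝ) ^ (d + 1))⁻¹ := by
    push_cast
    rw [mul_pow]
    field_simp
  rw [hlhs, hrhs, Finset.mul_sum, Finset.mul_sum, Finset.mul_sum]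
  refine Finset.sum_congr rfl fun B _ => ?_
  rw [← key]
  ring

end Trial

end Summit.QuantumFields.BalabanUV.T4Continuum.NE7K1LinTwoRunKit
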